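import Literature.AnabelianGeometry.AbsoluteAnabelian.MLFClosureCompactFixedUnits
import Literature.AnabelianGeometry.AbsoluteAnabelian.MLFGaloisUnitsFunctors

/-!
# The natural functor `𝒞^MLF_TLG → 𝒞^MLF_TCG` (units inside `k̄^×`) of [AbsTopIII] Definition 3.1 (iii): objects

S. Mochizuki, *Topics in absolute anabelian geometry III*, §3, Def. 3.1 (iii) p. 68 (bib key
`MochizukiAbsTopIII2015`; locators = kurims manuscript pages, lit key `paper:url-5493eb38cbb7`):
"… we thus obtain natural functors …; `𝒞^MLF_TLG → 𝒞^MLF_TCG` — i.e., by taking … the maximal compact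
subgroups of the subgroups of the arithmetic data obtained as subgroups of invariants for various open
subgroups of the Galois group"; Rmk. 3.1.1 p. 70: "`𝒪_k̄^× ⊆ k̄^×` may be characterized as the subgroup
of elements divisible by arbitrary powers of some prime number, while `𝒪_k̄^⊳ ⊆ k̄^×` may be
characterized as the submonoid generated by `𝒪_k̄^×` and the primes of Galois-invariant subfields".

This file (seat abc-iut-L4-t2; sub-DAG row P32.0.r0 / P32.v.L18 of `plan/L4/SUBDAG-AbsTopIII-Prop32.md`)
makes the FOURTH natural functor real on abstract pairs, reading "maximal compact subgroup at a finite
level" through Rmk. 3.1.1 (the typed arithmetic data carry no topology):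

* `GaloisMonoidPair.IsIntrinsicUnit P x` — for some prime `ℓ` and every `n`, `x` has an `ℓ^n`-th root
  fixed by the stabiliser of `x` in `Π` (divisibility at the finite level `k(x)`); transported by
  isomorphisms of pairs, `Π`-stable (`isIntrinsicUnit_smul_iff`); MODEL COMPARISON `isIntrinsicUnit_tlgPair_iff`: on
  `(Π_k ↷ k̄^×)` it means `x ∈ 𝒪_k̄^×` (the tree's Galois-theoretic Rmk. 3.1.1,
  `MLFClosure.mem_unitSubmonoid_iff_exists_prime_forall_exists_fixed_pow_eq`);
* OBJECTS: `GaloisMonoidPair.submonoidPair`, `intrinsicUnits`, `tlgUnitsPair P hP = (Π ↷ 𝒪^×(P))` for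
  MLF-Galois `TLG`-pairs, `actionKer_tlgUnitsPair` (`G_k` acts faithfully on `𝒪_k̄^×`), the model
  isomorphism `isoTLGUnitsOfModel : (Π_k ↷ 𝒪_k̄^×) ⥲ (Π ↷ 𝒪^×(P))`, `isMLFGaloisMonoidPair_TCG_tlgUnitsPair`,
  `Iso.tlgUnits` (functoriality on isomorphisms, unconditional);
* MORPHISMS and the FUNCTOR `tlgToTCG` on pairs with compact Galois group: file
  `MLFGaloisTLGUnitsFunctor.lean` (same mechanism as `MLFGaloisIntegersFunctor.lean` for `TF → TM`).

HONEST FRAMING: OUR kernel constructions of classical objects named by a refereed 2015 paper; nothing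
here bears on [IUTchIII] Cor. 3.12; typed ≠ proved for anything downstream.
-/

noncomputable section

universe u

namespace Literature.AnabelianGeometry.AbsoluteAnabelian

open _root_.CategoryTheory
open _root_.ValuativeRel
open Literature.NumberTheory.GaloisRepresentations
open scoped nonZeroDivisors

/-! ### Intrinsic units of a `TLG`-pair -/

namespace GaloisMonoidPair

variable (P : GaloisMonoidPair.{u}) {Q R : GaloisMonoidPair.{u}}

/-- **Rmk 3.1.1 / Def 3.1 (iii), intrinsic form of `𝒪^× ⊆ k̄^×`.**  An element `x` of the arithmetic data
`M ≅ k̄^×` of a `TLG`-pair `(Π ↷ M)` is an **intrinsic unit** if, for some prime `ℓ`, it admits for every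
`n` an `ℓ^n`-th root fixed by every element of `Π` fixing `x` ("divisible by arbitrary powers of some
prime number" in the invariants of an open subgroup). [cite: MochizukiAbsTopIII2015, Remark 3.1.1 p.70] -/
def IsIntrinsicUnit (x : P.M) : Prop :=
  ∃ ℓ : ℕ, ℓ.Prime ∧ ∀ n : ℕ, ∃ y : P.M, (∀ g : P.Pi, g • x = x → g • y = y) ∧ y ^ (ℓ ^ n) = x

variable {P}

/-- An isomorphism of pairs matches stabiliser-fixed elements. [cite: MochizukiAbsTopIII2015, Definition 3.1 (ii) p.67] -/
theorem Iso.forall_smul_eq_iff (e : GaloisMonoidPair.Iso P Q) (x y : P.M) :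
    (∀ g : P.Pi, g • x = x → g • y = y) ↔
      ∀ g : Q.Pi, g • e.isoM x = e.isoM x → g • e.isoM y = e.isoM y := by
  constructor
  · intro h g hg
    obtain ⟨g₀, rfl⟩ := e.isoPi.surjective g
    rw [← e.smul_comm] at hg ⊢
    rw [h g₀ (e.isoM.injective hg)]
  · intro h g hg
    have h1 := h (e.isoPi g) (by rw [← e.smul_comm, hg])
    rw [← e.smul_comm] at h1
    exact e.isoM.injective h1

/-- **Intrinsic units are transported by isomorphisms of pairs.** [cite: MochizukiAbsTopIII2015, Definition 3.1 (iii) p.68] -/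
theorem isIntrinsicUnit_iff_of_iso (e : GaloisMonoidPair.Iso P Q) (x : P.M) :
    P.IsIntrinsicUnit x ↔ Q.IsIntrinsicUnit (e.isoM x) := by
  unfold IsIntrinsicUnit
  refine exists_congr fun ℓ => and_congr_right fun _ => forall_congr' fun n => ?_
  constructor
  · rintro ⟨y, hy, hyx⟩
    exact ⟨e.isoM y, (e.forall_smul_eq_iff x y).mp hy, by rw [← map_pow, hyx]⟩
  · rintro ⟨y', hy', hy'x⟩
    refine ⟨e.isoM.symm y', (e.forall_smul_eq_iff x _).mpr (by simpa using hy'), ?_⟩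
    apply e.isoM.injective
    rw [map_pow, MulEquiv.apply_symm_apply, hy'x]

/-- Intrinsic units are stable under `Π`: `g • x` is an intrinsic unit iff `x` is (the stabiliser of
`g • x` is the conjugate of that of `x`). [cite: MochizukiAbsTopIII2015, Definition 3.1 (iii) p.68] -/
theorem isIntrinsicUnit_smul_iff (g : P.Pi) (x : P.M) :
    P.IsIntrinsicUnit (g • x) ↔ P.IsIntrinsicUnit x := by
  suffices key : ∀ (g : P.Pi) (x : P.M), P.IsIntrinsicUnit x → P.IsIntrinsicUnit (g • x) by
    refine ⟨fun h => ?_, key g x⟩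
    have h' := key g⁻¹ (g • x) h
    rwa [inv_smul_smul] at h'
  intro g x hx
  obtain ⟨ℓ, hℓ, h⟩ := hx
  refine ⟨ℓ, hℓ, fun n => ?_⟩
  obtain ⟨y, hy, hyx⟩ := h n
  refine ⟨g • y, fun g' hg' => ?_, by rw [← smul_pow', hyx]⟩
  have h1 : (g⁻¹ * g' * g) • x = x := by rw [mul_smul, mul_smul, hg', inv_smul_smul]
  have h2 := hy _ h1
  rw [mul_smul, mul_smul, inv_smul_eq_iff] at h2
  exact h2

variable (P)

/-- The action of `Π` on a `Π`-stable submonoid `S ⊆ M`, by monoid automorphisms.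
[cite: MochizukiAbsTopIII2015, Definition 3.1 (iii) p.68] -/
@[reducible] def submonoidAction (S : Submonoid P.M) (hS : ∀ (g : P.Pi) {x : P.M}, x ∈ S → g • x ∈ S) :
    MulDistribMulAction P.Pi S where
  smul g x := ⟨g • (x : P.M), hS g x.2⟩
  one_smul x := Subtype.ext (one_smul P.Pi (x : P.M))
  mul_smul g h x := Subtype.ext (mul_smul g h (x : P.M))
  smul_mul g x y := Subtype.ext (smul_mul' g (x : P.M) (y : P.M))
  smul_one g := Subtype.ext (smul_one g)

/-- The pair `(Π ↷ S)` cut out of `(Π ↷ M)` by a `Π`-stable submonoid `S ⊆ M`.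
[cite: MochizukiAbsTopIII2015, Definition 3.1 (iii) p.68] -/
abbrev submonoidPair (S : Submonoid P.M) (hS : ∀ (g : P.Pi) {x : P.M}, x ∈ S → g • x ∈ S) :
    GaloisMonoidPair.{u} where
  Pi := P.Pi
  M := S
  instAction := P.submonoidAction S hS
  isOpen_stabilizer x := by
    convert P.isOpen_stabilizer (x : P.M) using 1
    ext g
    exact Subtype.ext_iff

end GaloisMonoidPair

/-! ### Model comparison: on `(Π_k ↷ k̄^×)` the intrinsic units are `𝒪_k̄^×` -/

namespace ModelMLFGaloisData

variable (C : MLFClosure.{u}) (D : ModelMLFGaloisData C.k C.K)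

/-- **Rmk 3.1.1 for the model `TLG`-pair**: `x ∈ k̄^×` is an intrinsic unit of `(Π_k ↷ k̄^×)` iff
`x ∈ 𝒪_k̄^×` (the tree's Galois-theoretic Rmk 3.1.1, through `ε_k : Π_k ↠ G_k`).
[cite: MochizukiAbsTopIII2015, Remark 3.1.1 p.70] -/
theorem isIntrinsicUnit_tlgPair_iff (x : D.tlgPair.M) :
    D.tlgPair.IsIntrinsicUnit x ↔ (x : C.K) ∈ unitSubmonoid C.k C.K := by
  have hx0 : (x : C.K) ≠ 0 := nonZeroDivisors.coe_ne_zero x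
  rw [C.mem_unitSubmonoid_iff_exists_prime_forall_exists_fixed_pow_eq hx0]
  unfold GaloisMonoidPair.IsIntrinsicUnit
  refine exists_congr fun ℓ => and_congr_right fun hℓ => forall_congr' fun n => ?_
  constructor
  · rintro ⟨y, hy, hyx⟩
    refine ⟨(y : C.K), fun τ hτ => ?_, by rw [← hyx]; rfl⟩
    obtain ⟨g, rfl⟩ := D.aug_surjective τ
    exact congrArg Subtype.val (hy g (Subtype.ext hτ))
  · rintro ⟨y, hy, hyx⟩
    have hy0 : y ≠ 0 := by
      rintro rfl
      rw [zero_pow (pow_ne_zero n hℓ.ne_zero)] at hyx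
      exact hx0 hyx.symm
    exact ⟨⟨y, mem_nonZeroDivisors_of_ne_zero hy0⟩,
      fun g hg => Subtype.ext (hy (D.aug g) (congrArg Subtype.val hg)), Subtype.ext hyx⟩

/-- Rmk 3.1.1 at the level of a finite-index subgroup, for the model `TLG`-pair: an element of `k̄^×` with,
for some prime `ℓ` and all `n`, an `ℓ^n`-th root fixed by a finite-index `H ⊆ Π_k` is an intrinsic unit.
[cite: MochizukiAbsTopIII2015, Remark 3.1.1 p.70] -/
theorem tlgPair_isIntrinsicUnit_of_forall_exists_pow_eq_fixed (H : Subgroup D.tlgPair.Pi)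
    [H.FiniteIndex] {x : D.tlgPair.M} {ℓ : ℕ} (hℓ : ℓ.Prime)
    (h : ∀ n : ℕ, ∃ y : D.tlgPair.M, (∀ g ∈ H, g • y = y) ∧ y ^ (ℓ ^ n) = x) :
    D.tlgPair.IsIntrinsicUnit x :=
  (D.isIntrinsicUnit_tlgPair_iff C x).mpr
    (@ModelMLFGaloisData.mem_unitSubmonoid_of_forall_exists_pow_eq_fixed C D H ‹_› (x : C.K)
      (nonZeroDivisors.coe_ne_zero x) ℓ hℓ fun n => by
        obtain ⟨y, hy, hyx⟩ := h n
        exact ⟨(y : C.K), fun g hg => congrArg Subtype.val (hy g hg), by rw [← hyx]; rfl⟩)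

end ModelMLFGaloisData

/-! ### Objects: `(Π ↷ M) ↦ (Π ↷ 𝒪^×)` for MLF-Galois `TLG`-pairs -/

namespace GaloisMonoidPair

variable (P : GaloisMonoidPair.{u}) {Q R : GaloisMonoidPair.{u}}

/-- **Def 3.1 (iii), `𝒞^MLF_TLG → 𝒞^MLF_TCG` on objects**: the intrinsic unit group "`𝒪^×`" of an MLF-Galois
`TLG`-pair, a submonoid of `M ≅ k̄^×` (closure under multiplication transported from the model, where it
is `𝒪_k̄^×`). [cite: MochizukiAbsTopIII2015, Definition 3.1 (iii) p.68] -/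
def intrinsicUnits (hP : IsMLFGaloisMonoidPair .TLG P) : Submonoid P.M where
  carrier := {x | P.IsIntrinsicUnit x}
  one_mem' := by
    obtain ⟨C, D, Q₀, hQ₀, ⟨e⟩⟩ := hP.exists_model
    have hQ' : D.tlgPair = Q₀ := Option.some_injective _ (D.monoidPair_TLG.symm.trans hQ₀)
    subst hQ'
    have h1 : D.tlgPair.IsIntrinsicUnit 1 :=
      (D.isIntrinsicUnit_tlgPair_iff C 1).mpr (Submonoid.one_mem _)
    have h := (isIntrinsicUnit_iff_of_iso e 1).mp h1
    rwa [map_one] at h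
  mul_mem' {a b} ha hb := by
    obtain ⟨C, D, Q₀, hQ₀, ⟨e⟩⟩ := hP.exists_model
    have hQ' : D.tlgPair = Q₀ := Option.some_injective _ (D.monoidPair_TLG.symm.trans hQ₀)
    subst hQ'
    have ha' := (D.isIntrinsicUnit_tlgPair_iff C _).mp ((isIntrinsicUnit_iff_of_iso e.symm a).mp ha)
    have hb' := (D.isIntrinsicUnit_tlgPair_iff C _).mp ((isIntrinsicUnit_iff_of_iso e.symm b).mp hb)
    have hab : D.tlgPair.IsIntrinsicUnit (e.symm.isoM a * e.symm.isoM b) :=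
      (D.isIntrinsicUnit_tlgPair_iff C _).mpr (Submonoid.mul_mem _ ha' hb')
    have h := (isIntrinsicUnit_iff_of_iso e _).mp hab
    rwa [map_mul, show e.isoM (e.symm.isoM a) = a from e.isoM.apply_symm_apply a,
      show e.isoM (e.symm.isoM b) = b from e.isoM.apply_symm_apply b] at h

/-- Membership in `intrinsicUnits`. [cite: MochizukiAbsTopIII2015, Definition 3.1 (iii) p.68] -/
@[simp] theorem mem_intrinsicUnits (hP : IsMLFGaloisMonoidPair .TLG P) (x : P.M) :
    x ∈ P.intrinsicUnits hP ↔ P.IsIntrinsicUnit x := Iff.rfl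

/-- **Def 3.1 (iii), `𝒞^MLF_TLG → 𝒞^MLF_TCG` on objects: `(Π ↷ M) ↦ (Π ↷ 𝒪^×)`.**
[cite: MochizukiAbsTopIII2015, Definition 3.1 (iii) p.68] -/
abbrev tlgUnitsPair (hP : IsMLFGaloisMonoidPair .TLG P) : GaloisMonoidPair.{u} :=
  P.submonoidPair (P.intrinsicUnits hP) (fun g _ hx => (isIntrinsicUnit_smul_iff g _).mpr hx)

/-- The topological group of `P.tlgUnitsPair` is that of `P`. [cite: MochizukiAbsTopIII2015, Definition 3.1 (iii) p.68] -/
theorem tlgUnitsPair_Pi (hP : IsMLFGaloisMonoidPair .TLG P) : (P.tlgUnitsPair hP).Pi = P.Pi := rfl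

/-- The arithmetic data of `P.tlgUnitsPair` is the intrinsic `𝒪^×`. [cite: MochizukiAbsTopIII2015, Definition 3.1 (iii) p.68] -/
theorem tlgUnitsPair_M (hP : IsMLFGaloisMonoidPair .TLG P) : (P.tlgUnitsPair hP).M = P.intrinsicUnits hP := rfl

variable {P}

/-- **Functoriality on isomorphisms of pairs** (unconditional). [cite: MochizukiAbsTopIII2015, Definition 3.1 (iii) p.68] -/
def Iso.tlgUnits (e : GaloisMonoidPair.Iso P Q) (hP : IsMLFGaloisMonoidPair .TLG P)
    (hQ : IsMLFGaloisMonoidPair .TLG Q) : GaloisMonoidPair.Iso (P.tlgUnitsPair hP) (Q.tlgUnitsPair hQ) where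
  isoPi := e.isoPi
  isoM :=
    { toFun := fun m => ⟨e.isoM m, (isIntrinsicUnit_iff_of_iso e (m : P.M)).mp m.2⟩
      invFun := fun m => ⟨e.isoM.symm m, (isIntrinsicUnit_iff_of_iso e.symm (m : Q.M)).mp m.2⟩
      left_inv := fun m => Subtype.ext (e.isoM.symm_apply_apply (m : P.M))
      right_inv := fun m => Subtype.ext (e.isoM.apply_symm_apply (m : Q.M))
      map_mul' := fun m m' => Subtype.ext (map_mul e.isoM (m : P.M) (m' : P.M)) }
  smul_comm g m := Subtype.ext (e.smul_comm g (m : P.M))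

/-- The Galois component of `e.tlgUnits` is that of `e`. [cite: MochizukiAbsTopIII2015, Definition 3.1 (iii) p.68] -/
@[simp] theorem Iso.tlgUnits_isoPi (e : GaloisMonoidPair.Iso P Q) (hP hQ) :
    (e.tlgUnits hP hQ).isoPi = e.isoPi := rfl

end GaloisMonoidPair

namespace ModelMLFGaloisData

variable (C : MLFClosure.{u}) (D : ModelMLFGaloisData C.k C.K) {P : GaloisMonoidPair.{u}}

/-- **On the model the functor is Def 3.1 (i)**: an isomorphism `(Π_k ↷ k̄^×) ⥲ P` induces
`(Π_k ↷ 𝒪_k̄^×) ⥲ (Π_P ↷ 𝒪^×(P))`. [cite: MochizukiAbsTopIII2015, Definition 3.1 (iii) p.68] -/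
def isoTLGUnitsOfModel (e : GaloisMonoidPair.Iso D.tlgPair P) (hP : IsMLFGaloisMonoidPair .TLG P) :
    GaloisMonoidPair.Iso D.tcgPair (P.tlgUnitsPair hP) where
  isoPi := e.isoPi
  isoM :=
    { toFun := fun u =>
        ⟨e.isoM ⟨(u : C.K), mem_nonZeroDivisors_of_ne_zero ((mem_unitSubmonoid_iff C.k C.K).mp u.2).1⟩,
          (GaloisMonoidPair.isIntrinsicUnit_iff_of_iso e _).mp ((D.isIntrinsicUnit_tlgPair_iff C _).mpr u.2)⟩
      invFun := fun y =>
        ⟨((e.isoM.symm (y : P.M) : D.tlgPair.M) : C.K),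
          (D.isIntrinsicUnit_tlgPair_iff C _).mp
            ((GaloisMonoidPair.isIntrinsicUnit_iff_of_iso e.symm (y : P.M)).mp y.2)⟩
      left_inv := fun u => Subtype.ext (by
        change ((e.isoM.symm (e.isoM _) : D.tlgPair.M) : C.K) = (u : C.K)
        rw [e.isoM.symm_apply_apply])
      right_inv := fun y => Subtype.ext (by
        change e.isoM ⟨((e.isoM.symm (y : P.M) : D.tlgPair.M) : C.K), _⟩ = (y : P.M)
        have : (⟨((e.isoM.symm (y : P.M) : D.tlgPair.M) : C.K),
            mem_nonZeroDivisors_of_ne_zero ((mem_unitSubmonoid_iff C.k C.K).mp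
              ((D.isIntrinsicUnit_tlgPair_iff C _).mp
                ((GaloisMonoidPair.isIntrinsicUnit_iff_of_iso e.symm (y : P.M)).mp y.2))).1⟩ : D.tlgPair.M) =
            e.isoM.symm (y : P.M) := Subtype.ext rfl
        rw [this, e.isoM.apply_symm_apply])
      map_mul' := fun u v => Subtype.ext (by
        change e.isoM _ = e.isoM _ * e.isoM _
        rw [← map_mul]
        rfl) }
  smul_comm g u := Subtype.ext (e.smul_comm g
    ⟨(u : C.K), mem_nonZeroDivisors_of_ne_zero ((mem_unitSubmonoid_iff C.k C.K).mp u.2).1⟩)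

/-- **Def 3.1 (iii) preserves MLF-Galois pairs, `TLG ↦ TCG`.** [cite: MochizukiAbsTopIII2015, Definition 3.1 (iii) p.68] -/
theorem _root_.Literature.AnabelianGeometry.AbsoluteAnabelian.GaloisMonoidPair.isMLFGaloisMonoidPair_TCG_tlgUnitsPair
    {P : GaloisMonoidPair.{u}} (hP : IsMLFGaloisMonoidPair .TLG P) :
    IsMLFGaloisMonoidPair .TCG (P.tlgUnitsPair hP) := by
  obtain ⟨C, D, Q₀, hQ₀, ⟨e⟩⟩ := hP.exists_model
  have hQ' : D.tlgPair = Q₀ := Option.some_injective _ (D.monoidPair_TLG.symm.trans hQ₀)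
  subst hQ'
  exact ⟨⟨C, D, D.tcgPair, D.monoidPair_TCG, ⟨isoTLGUnitsOfModel C D e hP⟩⟩⟩

/-- For the model `TLG`-pair, an element of `Π_k` fixing every unit `𝒪_k̄^×` acts trivially on `k̄^×`
(**`G_k` acts faithfully on `𝒪_k̄^×`**: a non-unit integer `z` has `1 + z ∈ 𝒪_k̄^×`, and every element of
`k̄^×` is an integer or the inverse of one). [cite: MochizukiAbsTopIII2015, Definition 3.1 (ii) p.67] -/
theorem tlgPair_smul_eq_of_forall_unit (g : D.tlgPair.Pi)
    (h : ∀ x : D.tlgPair.M, (x : C.K) ∈ unitSubmonoid C.k C.K → g • x = x) (x : D.tlgPair.M) :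
    g • x = x := by
  have hunit : ∀ z ∈ unitSubmonoid C.k C.K, D.aug g z = z := fun z hz =>
    congrArg Subtype.val (h ⟨z, mem_nonZeroDivisors_of_ne_zero ((mem_unitSubmonoid_iff C.k C.K).mp hz).1⟩ hz)
  have hint : ∀ z ∈ nonzeroIntegers C.k C.K, D.aug g z = z := by
    intro z hz
    by_cases hzu : z ∈ unitSubmonoid C.k C.K
    · exact hunit z hzu
    · have h1 := hunit (1 + z) (one_add_mem_unitSubmonoid_of_mem_integersClosure C hz.1 hzu)
      rw [map_add, map_one] at h1
      exact add_left_cancel h1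
  apply Subtype.ext
  change D.aug g • (x : C.K) = x
  rcases C.mem_nonzeroIntegers_or_inv_mem (nonZeroDivisors.coe_ne_zero x) with hx | hx
  · exact hint _ hx
  · have h2 := hint _ hx
    rw [map_inv₀] at h2
    exact inv_injective h2

end ModelMLFGaloisData

namespace GaloisMonoidPair

variable {P Q R : GaloisMonoidPair.{u}}

/-- **The arithmetic quotients of `(Π ↷ M)` and `(Π ↷ 𝒪^×)` agree** for an MLF-Galois `TLG`-pair
(transport of `tlgPair_smul_eq_of_forall_unit`). [cite: MochizukiAbsTopIII2015, Definition 3.1 (ii) p.67] -/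
theorem actionKer_tlgUnitsPair (hP : IsMLFGaloisMonoidPair .TLG P) : (P.tlgUnitsPair hP).actionKer = P.actionKer := by
  obtain ⟨C, D, Q₀, hQ₀, ⟨e⟩⟩ := hP.exists_model
  have hQ' : D.tlgPair = Q₀ := Option.some_injective _ (D.monoidPair_TLG.symm.trans hQ₀)
  subst hQ'
  ext g
  rw [GaloisMonoidPair.mem_actionKer_iff, GaloisMonoidPair.mem_actionKer_iff]
  constructor
  · intro h x
    obtain ⟨g₀, rfl⟩ := e.isoPi.surjective g
    have hx : e.isoM (e.isoM.symm x) = x := e.isoM.apply_symm_apply x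
    rw [← hx, ← e.smul_comm]
    congr 1
    refine D.tlgPair_smul_eq_of_forall_unit C g₀ (fun z hz => ?_) _
    have hz' : P.IsIntrinsicUnit (e.isoM z) :=
      (isIntrinsicUnit_iff_of_iso e z).mp ((D.isIntrinsicUnit_tlgPair_iff C z).mpr hz)
    have h1 := congrArg Subtype.val (h ⟨e.isoM z, hz'⟩)
    change e.isoPi g₀ • e.isoM z = e.isoM z at h1
    rw [← e.smul_comm] at h1
    exact e.isoM.injective h1
  · intro h m
    exact Subtype.ext (h (m : P.M))

end GaloisMonoidPair

end Literature.AnabelianGeometry.AbsoluteAnabelian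

end
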